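import Summits.QuantumFields.BalabanUV.T4Continuum.Support.NE3MajorantProfileTower
import Summits.QuantumFields.BalabanUV.T4Continuum.Support.NE3CovariantLineSumsError
import Summits.QuantumFields.BalabanUV.T4Continuum.Support.NE3ProjectedLandauProjection

/-!
# NE7MajorantColumnSums — THE TRANSPOSED (COLUMN-SUM ∕ `ℓ¹ → ℓ¹`) BOUND OF ROW NE3's MAJORANT TOWER OF THE LINEARISED DOUBLE-BAR AVERAGE: for a non-negative periodic bond weight `ω`,
# `Σ_{z ∈ periodBox N′} Σ_κ majIter d L j x ω (z,κ) ≤ colProd d L j x · Σ_{y ∈ periodBox (L^j·N′)} Σ_μ ω (y,μ)`, `colProd d L j x = Π_{i<j} (L^{1−d} + d·wC(xᵢ)) ≤ 2·(L^{1−d})^j`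
# under `d·L^{d−1}·Ssum ≤ 1∕2` — the transverse dilution `L^{1−d}` per level that makes the `ℓ^∞` bound of the ADJOINT `Q̄_W†` (F200's letter `c_Q*`) of order `M^{1−d}`
# (file 158 of the curved (APE), F228)

Cell `pub-balaban`, rung (B)+1 sub-cell t4, lineage `b2b-balaban-t4-ne7-p1` (CRUX PROVER NE7 #1 = OWNER of row NE7), generation 86; memo
`t4/b2b-balaban-t4-ne7-p1-g86/ORBIT-COMPARISON.md` §6.  Over row NE3's `NE3QbarIterMajorant` (`lsum`, `segW`, `loopW`, `treeW'`, `locW`, `stepMaj`, `majIter`, `wlin`), `NE3CovariantLineSumsError`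
(`Csup`, `wC`, `Ssum`), `NE3MajorantProfile.lsum_seg_eq_sum`, `NE3BlockLineAverage.sum_periodBox_blocks`∕`sum_univ_boxVec` and `T4AveragingDeficitWallBoundary.sum_periodBox_shift` BY NAME.
WHY.  Row NE3 evaluated the majorant tower on sup-type weights (ROW sums: `majIter (const s) ≤ Lprod·s`, `Lprod ≤ 2L^j` — the `ℓ^∞` bound `c_Q = 2M` of F205).  F200 splits the END's rows
(C) of the constrained propagator into print's separate rows once ALSO `c_Q* = ‖Q̄_W†‖_{∞→∞}` is known; by duality that is the `ℓ¹ → ℓ¹` bound of `Q̄_W`, i.e. the COLUMN sums of the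
majorant: one spiked bond enters `L` straight segments of ONE (or two) blocks with weight `L^{−d}` each (`L^{1−d}`), and the loop ∕ tree ∕ segment words of the local defect at most
`Csup`-many times per direction, weighted by the small `wlin·x`.
WHAT ([folklore]; 0 sorry; one real-valued bookkeeping def `colProd` → definition lane).  §1 periodic sums (`NE3ProjectedLandauProjection.zero_mem_periodBox` by name): `sum_corner_translate_le`, `sum_corner_lsum_le` (`Σ_z lsum ω (L•z + c) w ≤ |w|·‖ω‖₁`),
`lsum_add_period`, `stepMaj_add_period`; §2 one level: `sum_segStep_le` (`≤ L^{1−d}‖ω‖₁`), `sum_locStep_le` (`≤ d·Csup·‖ω‖₁`), **`sum_stepMaj_le`** (`≤ (L^{1−d} + d·wC)·‖ω‖₁`);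
§3 the tower: `colProd`, **`sum_majIter_le`**; §4 the class: `colProd_mul_le` (`colProd·(1 − dL^{d−1}Ssum) ≤ (L^{1−d})^j`), **`colProd_le_two_mul`**.
HONEST FRAMING (page 1): positive-operator bookkeeping on OUR majorant; no estimate of Bałaban's; `c_Q*` itself is the next file; the rows (C), (KL-B), (APE) on curved data NOT proved here;
NOT ONE-STEP, NOT NE7; spine 0∕9; finite T⁴ rung (B)+1 — NOT infinite volume, NOT mass gap, NOT `BetaPertH`, NOT Clay.  Continuum YM on T⁴ ⇐ BetaPertH ∧ nine spine estimates (0/9 proved);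
BetaPertH ⇐ (D1) ∧ (D4) ∧ CAP+tail; G-an2-4 gates asym, D1 and NE2/3/4.
-/

set_option autoImplicit false

open scoped BigOperators
open Finset

namespace Summit.QuantumFields.BalabanUV.T4Continuum.NE7MajorantColumnSums

open Literature.MathematicalPhysics.QuantumFieldTheory.Balaban1983to89
open B7Prop1Explicit
open T4AveragingDeficitWallBoundary (periodBox mem_periodBox sum_periodBox_shift)
open AveragingDeficitTwoLevelPrep (prop1Radius)
open AveragingDeficitMultiLevelPrep (prop1Radius_nonneg)
open AveragingDeficitSideDeriv (loopWord length_loopWord)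
open NE3BlockLineAverage (sum_univ_boxVec sum_periodBox_blocks)
open NE3QbarIterMajorant (lsum lsum_nil lsum_cons lsum_nonneg segW loopW treeW' locW wlin wlin_nonneg segStep locStep stepMaj stepMaj_apply stepMaj_nonneg
  majIter majIter_zero majIter_succ)
open NE3MajorantProfile (lsum_seg_eq_sum)
open NE3CovariantLineSumsError (Csup Csup_nonneg wC wC_nonneg Ssum Ssum_nonneg Ssum_succ)
open NE3ProjectedLandauProjection (zero_mem_periodBox)

noncomputable section

variable {d : ℕ}

/-! ## §1 Periodic sums -/

/-- **CORNER TRANSLATES ARE DOMINATED BY THE FULL BOX**: for a non-negative `(L·N′)`-periodic `g` and any offset `c`,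
`Σ_{z ∈ periodBox N′} g (L•z + c) ≤ Σ_{y ∈ periodBox (L·N′)} g y` (`L ≥ 1`). [folklore] -/
theorem sum_corner_translate_le {L N' : ℕ} (hL : 1 ≤ L) (hN : 1 ≤ N') {g : Site d → ℝ} (hg0 : ∀ y, 0 ≤ g y)
    (hgP : ∀ (y : Site d) (i : Fin d), g (y + ((L * N' : ℕ) : ℤ) • e i) = g y) (c : Site d) :
    ∑ z ∈ periodBox (d := d) N', g ((L : ℤ) • z + c) ≤ ∑ y ∈ periodBox (d := d) (L * N'), g y := by
  have hMN : 1 ≤ L * N' := Nat.one_le_iff_ne_zero.mpr (Nat.mul_ne_zero (by omega) (by omega))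
  calc ∑ z ∈ periodBox (d := d) N', g ((L : ℤ) • z + c)
      ≤ ∑ z ∈ periodBox (d := d) N', ∑ v ∈ periodBox (d := d) L, g ((L : ℤ) • z + v + c) := by
        refine Finset.sum_le_sum fun z _ => ?_
        have h := Finset.single_le_sum (f := fun v => g ((L : ℤ) • z + v + c)) (fun v _ => hg0 _) (zero_mem_periodBox (d := d) hL)
        simpa using h
    _ = ∑ y ∈ periodBox (d := d) (L * N'), g (y + c) := sum_periodBox_blocks L N' hL (fun y => g (y + c))
    _ = ∑ y ∈ periodBox (d := d) (L * N'), g y := sum_periodBox_shift (L * N') hMN hgP c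

/-- **THE `ℓ¹` OF A WORD WEIGHT OVER CORNER BASES**: `Σ_{z ∈ periodBox N′} lsum ω (L•z + c) w ≤ |w|·Σ_{y ∈ periodBox (L·N′)} Σ_μ ω y μ` for non-negative `(L·N′)`-periodic `ω`. [folklore] -/
theorem sum_corner_lsum_le {L N' : ℕ} (hL : 1 ≤ L) (hN : 1 ≤ N') {ω : Site d → Fin d → ℝ} (hω0 : ∀ y μ, 0 ≤ ω y μ)
    (hωP : ∀ (y : Site d) (μ : Fin d) (i : Fin d), ω (y + ((L * N' : ℕ) : ℤ) • e i) μ = ω y μ) :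
    ∀ (w : List (Letter d)) (c : Site d),
      ∑ z ∈ periodBox (d := d) N', lsum ω ((L : ℤ) • z + c) w ≤ w.length * ∑ y ∈ periodBox (d := d) (L * N'), ∑ μ : Fin d, ω y μ
  | [], c => by simp
  | l :: w, c => by
      have ih := sum_corner_lsum_le hL hN hω0 hωP w (c + l.vec)
      -- the first letter sits at `L•z + c'` with `c' = c` or `c + l.vec`
      have hc : ∀ z : Site d, (if l.2 then (L : ℤ) • z + c else (L : ℤ) • z + c + l.vec) = (L : ℤ) • z + (if l.2 then c else c + l.vec) := by
        intro z; split_ifs <;> abel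
      have hfirst : ∑ z ∈ periodBox (d := d) N', ω ((L : ℤ) • z + (if l.2 then c else c + l.vec)) l.1
          ≤ ∑ y ∈ periodBox (d := d) (L * N'), ∑ μ : Fin d, ω y μ :=
        calc ∑ z ∈ periodBox (d := d) N', ω ((L : ℤ) • z + (if l.2 then c else c + l.vec)) l.1
            ≤ ∑ y ∈ periodBox (d := d) (L * N'), ω y l.1 :=
              sum_corner_translate_le hL hN (g := fun y => ω y l.1) (fun y => hω0 y _) (fun y i => hωP y _ i) _
          _ ≤ ∑ y ∈ periodBox (d := d) (L * N'), ∑ μ : Fin d, ω y μ :=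
              Finset.sum_le_sum fun y _ => Finset.single_le_sum (f := fun μ => ω y μ) (fun μ _ => hω0 y μ) (Finset.mem_univ l.1)
      have e : ∀ z : Site d, (L : ℤ) • z + c + l.vec = (L : ℤ) • z + (c + l.vec) := fun z => by abel
      have hsplit : ∀ z : Site d, lsum ω ((L : ℤ) • z + c) (l :: w)
          = ω ((L : ℤ) • z + (if l.2 then c else c + l.vec)) l.1 + lsum ω ((L : ℤ) • z + (c + l.vec)) w := by
        intro z; rw [lsum_cons, hc z, e z]
      simp_rw [hsplit]
      rw [Finset.sum_add_distrib, List.length_cons, Nat.cast_succ]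
      linarith

/-- Translating the base point = translating the weight. [folklore] -/
theorem lsum_shift (ω : Site d → Fin d → ℝ) (v : Site d) :
    ∀ (w : List (Letter d)) (x : Site d), lsum ω (x + v) w = lsum (fun y μ => ω (y + v) μ) x w
  | [], x => by simp
  | l :: w, x => by
      rw [lsum_cons, lsum_cons]
      have e1 : x + v + l.vec = (x + l.vec) + v := by abel
      have e2 : (if l.2 then x + v else (x + l.vec) + v) = (if l.2 then x else x + l.vec) + v := by split_ifs <;> rfl
      rw [e1, lsum_shift ω v w (x + l.vec), e2]

/-- `lsum` of a periodic weight is periodic in the base point. [folklore] -/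
theorem lsum_add_period {ω : Site d → Fin d → ℝ} {T : ℤ} {i : Fin d} (hωP : ∀ (y : Site d) (μ : Fin d), ω (y + T • e i) μ = ω y μ)
    (w : List (Letter d)) (x : Site d) : lsum ω (x + T • e i) w = lsum ω x w := by
  have hfun : (fun (y : Site d) (μ : Fin d) => ω (y + T • e i) μ) = ω := funext fun y => funext fun μ => hωP y μ
  rw [lsum_shift, hfun]

/-- **THE MAJORANT STEP OF AN `(L·T)`-PERIODIC WEIGHT IS `T`-PERIODIC** on the coarse lattice. [folklore] -/
theorem stepMaj_add_period (L : ℕ) (x : ℝ) {ω : Site d → Fin d → ℝ} {T : ℕ}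
    (hωP : ∀ (y : Site d) (μ : Fin d) (i : Fin d), ω (y + ((L * T : ℕ) : ℤ) • e i) μ = ω y μ) (z : Site d) (i : Fin d) (κ : Fin d) :
    stepMaj d L x ω (z + (T : ℤ) • e i) κ = stepMaj d L x ω z κ := by
  have hP : ∀ (y : Site d) (μ : Fin d), ω (y + (((L * T : ℕ) : ℤ)) • e i) μ = ω y μ := fun y μ => hωP y μ i
  have hcorner : (L : ℤ) • (z + (T : ℤ) • e i) = (L : ℤ) • z + ((L * T : ℕ) : ℤ) • e i := by
    push_cast; rw [smul_add, smul_smul]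
  have hseg : ∀ (q : Site d) (w : List (Letter d)) (v : Site d), lsum ω (q + ((L * T : ℕ) : ℤ) • e i + v) w = lsum ω (q + v) w := by
    intro q w v
    rw [show q + ((L * T : ℕ) : ℤ) • e i + v = (q + v) + ((L * T : ℕ) : ℤ) • e i by abel]
    exact lsum_add_period hP w _
  have hseg0 : ∀ (q : Site d) (w : List (Letter d)), lsum ω (q + ((L * T : ℕ) : ℤ) • e i) w = lsum ω q w := fun q w => lsum_add_period hP w q
  rw [stepMaj_apply, stepMaj_apply, hcorner]
  unfold segW locW loopW treeW'
  simp only [hseg, hseg0]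

/-! ## §2 One level: column sums of the straight step and of the local defect step -/

/-- **THE STRAIGHT STEP DILUTES TRANSVERSALLY**: `Σ_{z ∈ periodBox N′} Σ_κ segStep L ω (z,κ) ≤ L^{1−d}·Σ_{y ∈ periodBox (L·N′)} Σ_μ ω y μ` (`L ≥ 1`, `ω ≥ 0` `(L·N′)`-periodic). [folklore] -/
theorem sum_segStep_le {L N' : ℕ} (hL : 1 ≤ L) (hN : 1 ≤ N') {ω : Site d → Fin d → ℝ}
    (hωP : ∀ (y : Site d) (μ : Fin d) (i : Fin d), ω (y + ((L * N' : ℕ) : ℤ) • e i) μ = ω y μ) :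
    ∑ z ∈ periodBox (d := d) N', ∑ κ : Fin d, segStep L ω z κ
      ≤ ((L : ℝ) ^ d)⁻¹ * L * ∑ y ∈ periodBox (d := d) (L * N'), ∑ μ : Fin d, ω y μ := by
  have hMN : 1 ≤ L * N' := Nat.one_le_iff_ne_zero.mpr (Nat.mul_ne_zero (by omega) (by omega))
  have hseg : ∀ (z : Site d) (κ : Fin d), segStep L ω z κ
      = ((L : ℝ) ^ d)⁻¹ * ∑ v ∈ periodBox (d := d) L, ∑ i ∈ Finset.range L, ω ((L : ℤ) • z + v + (i : ℤ) • e κ) κ := by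
    intro z κ
    unfold segStep segW
    rw [← Finset.mul_sum, ← sum_univ_boxVec L (fun v => ∑ i ∈ Finset.range L, ω ((L : ℤ) • z + v + (i : ℤ) • e κ) κ)]
    congr 1
    exact Finset.sum_congr rfl fun r _ => lsum_seg_eq_sum ω κ L _
  have hM0 : (0 : ℝ) ≤ ((L : ℝ) ^ d)⁻¹ := by positivity
  -- `Σ_z Σ_v Σ_i ω(L•z + v + i e_κ, κ) = Σ_i Σ_y ω(y + i e_κ, κ) = L·Σ_y ω(y,κ)` for each `κ`
  have hκ : ∀ κ : Fin d, ∑ z ∈ periodBox (d := d) N', ∑ v ∈ periodBox (d := d) L, ∑ i ∈ Finset.range L, ω ((L : ℤ) • z + v + (i : ℤ) • e κ) κ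
      = L * ∑ y ∈ periodBox (d := d) (L * N'), ω y κ := by
    intro κ
    rw [sum_periodBox_blocks L N' hL (fun y => ∑ i ∈ Finset.range L, ω (y + (i : ℤ) • e κ) κ), Finset.sum_comm]
    rw [Finset.sum_congr rfl fun (i : ℕ) _ => sum_periodBox_shift (L * N') hMN (g := fun y => ω y κ) (fun y i' => hωP y κ i') (((i : ℕ) : ℤ) • e κ)]
    rw [Finset.sum_const, Finset.card_range, nsmul_eq_mul]
  have hcount : ∑ κ : Fin d, ∑ z ∈ periodBox (d := d) N', ∑ v ∈ periodBox (d := d) L, ∑ i ∈ Finset.range L, ω ((L : ℤ) • z + v + (i : ℤ) • e κ) κ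
      = L * ∑ y ∈ periodBox (d := d) (L * N'), ∑ μ : Fin d, ω y μ := by
    simp_rw [hκ]
    rw [← Finset.mul_sum, Finset.sum_comm]
  calc ∑ z ∈ periodBox (d := d) N', ∑ κ : Fin d, segStep L ω z κ
      = ∑ z ∈ periodBox (d := d) N', ∑ κ : Fin d, ((L : ℝ) ^ d)⁻¹ * ∑ v ∈ periodBox (d := d) L, ∑ i ∈ Finset.range L, ω ((L : ℤ) • z + v + (i : ℤ) • e κ) κ := by
        simp_rw [hseg]
    _ = ((L : ℝ) ^ d)⁻¹ * ∑ κ : Fin d, ∑ z ∈ periodBox (d := d) N', ∑ v ∈ periodBox (d := d) L, ∑ i ∈ Finset.range L, ω ((L : ℤ) • z + v + (i : ℤ) • e κ) κ := by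
        rw [Finset.sum_comm, Finset.mul_sum]
        refine Finset.sum_congr rfl fun κ _ => ?_
        rw [Finset.mul_sum]
    _ = ((L : ℝ) ^ d)⁻¹ * L * ∑ y ∈ periodBox (d := d) (L * N'), ∑ μ : Fin d, ω y μ := by rw [hcount]; ring
    _ ≤ _ := le_rfl

/-- **THE LOCAL DEFECT STEP HAS COLUMN SUMS `≤ d·Csup`**: `Σ_{z ∈ periodBox N′} Σ_κ locStep L ω (z,κ) ≤ d·Csup d L·Σ_{y ∈ periodBox (L·N′)} Σ_μ ω y μ`. [folklore] -/
theorem sum_locStep_le {L N' : ℕ} (hL : 1 ≤ L) (hN : 1 ≤ N') {ω : Site d → Fin d → ℝ} (hω0 : ∀ y μ, 0 ≤ ω y μ)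
    (hωP : ∀ (y : Site d) (μ : Fin d) (i : Fin d), ω (y + ((L * N' : ℕ) : ℤ) • e i) μ = ω y μ) :
    ∑ z ∈ periodBox (d := d) N', ∑ κ : Fin d, locStep L ω z κ
      ≤ d * Csup d L * ∑ y ∈ periodBox (d := d) (L * N'), ∑ μ : Fin d, ω y μ := by
  set S : ℝ := ∑ y ∈ periodBox (d := d) (L * N'), ∑ μ : Fin d, ω y μ with hS
  have hS0 : 0 ≤ S := Finset.sum_nonneg fun y _ => Finset.sum_nonneg fun μ _ => hω0 y μ
  have hLd0 : (0 : ℝ) ≤ ((L : ℝ) ^ d)⁻¹ := by positivity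
  have hLd1 : ((L : ℝ) ^ d)⁻¹ * (Fintype.card (Fin d → Fin L) : ℝ) = 1 := by
    rw [Fintype.card_fun, Fintype.card_fin, Fintype.card_fin]; push_cast
    rw [inv_mul_cancel₀ (by positivity)]
  -- per direction κ: the four pieces of `locW`
  have hsegq : ∀ κ : Fin d, ∑ z ∈ periodBox (d := d) N', lsum ω ((L : ℤ) • z) (seg κ L) ≤ L * S := by
    intro κ
    have h := sum_corner_lsum_le (N' := N') hL hN hω0 hωP (seg κ L) 0
    simp only [add_zero, length_seg, Int.natAbs_natCast] at h
    exact h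
  have hloop : ∀ κ : Fin d, ∑ z ∈ periodBox (d := d) N', loopW L ω ((L : ℤ) • z) κ ≤ (2 * (d * L) + 2 * L) * S := by
    intro κ
    unfold loopW
    rw [Finset.sum_comm]
    calc ∑ r : Fin d → Fin L, ∑ z ∈ periodBox (d := d) N', ((L : ℝ) ^ d)⁻¹ * lsum ω ((L : ℤ) • z) (loopWord L κ (boxVec L r))
        ≤ ∑ _r : Fin d → Fin L, ((L : ℝ) ^ d)⁻¹ * ((2 * (d * L) + 2 * L) * S) := by
          refine Finset.sum_le_sum fun r _ => ?_
          rw [← Finset.mul_sum]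
          refine mul_le_mul_of_nonneg_left ?_ hLd0
          have h := sum_corner_lsum_le (N' := N') hL hN hω0 hωP (loopWord L κ (boxVec L r)) 0
          simp only [add_zero, length_loopWord] at h
          have hl := l1_boxVec_le (L := L) r
          have hlen : ((2 * l1 (boxVec L r) + 2 * L : ℕ) : ℝ) ≤ 2 * (d * L) + 2 * L := by
            have : (l1 (boxVec L r) : ℝ) ≤ d * L := by exact_mod_cast hl
            push_cast; linarith
          exact h.trans (mul_le_mul_of_nonneg_right hlen hS0)
      _ = (2 * (d * L) + 2 * L) * S := by
          rw [Finset.sum_const, Finset.card_univ, nsmul_eq_mul, ← mul_assoc, mul_comm (Fintype.card (Fin d → Fin L) : ℝ), hLd1, one_mul]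
  have htree : ∀ κ : Fin d, ∑ z ∈ periodBox (d := d) N', treeW' L ω ((L : ℤ) • z) κ ≤ (d * L) * S := by
    intro κ
    unfold treeW'
    rw [Finset.sum_comm]
    calc ∑ r : Fin d → Fin L, ∑ z ∈ periodBox (d := d) N', ((L : ℝ) ^ d)⁻¹ * lsum ω ((L : ℤ) • z + (L : ℤ) • e κ) (treeWord (boxVec L r))
        ≤ ∑ _r : Fin d → Fin L, ((L : ℝ) ^ d)⁻¹ * ((d * L) * S) := by
          refine Finset.sum_le_sum fun r _ => ?_
          rw [← Finset.mul_sum]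
          refine mul_le_mul_of_nonneg_left ?_ hLd0
          have h := sum_corner_lsum_le (N' := N') hL hN hω0 hωP (treeWord (boxVec L r)) ((L : ℤ) • e κ)
          simp only [length_treeWord] at h
          have hl := l1_boxVec_le (L := L) r
          have hlen : ((l1 (boxVec L r) : ℕ) : ℝ) ≤ d * L := by exact_mod_cast hl
          exact h.trans (mul_le_mul_of_nonneg_right hlen hS0)
      _ = (d * L) * S := by
          rw [Finset.sum_const, Finset.card_univ, nsmul_eq_mul, ← mul_assoc, mul_comm (Fintype.card (Fin d → Fin L) : ℝ), hLd1, one_mul]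
  have hκ : ∀ κ : Fin d, ∑ z ∈ periodBox (d := d) N', locStep L ω z κ ≤ Csup d L * S := by
    intro κ
    unfold locStep locW
    simp only [Finset.sum_add_distrib, ← Finset.mul_sum]
    have h1 := hloop κ; have h2 := hsegq κ; have h3 := htree κ
    unfold Csup BlockAverageVaryHolo.nbRad
    push_cast
    nlinarith [h1, h2, h3, hS0]
  calc ∑ z ∈ periodBox (d := d) N', ∑ κ : Fin d, locStep L ω z κ
      = ∑ κ : Fin d, ∑ z ∈ periodBox (d := d) N', locStep L ω z κ := Finset.sum_comm
    _ ≤ ∑ _κ : Fin d, Csup d L * S := Finset.sum_le_sum fun κ _ => hκ κ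
    _ = d * Csup d L * S := by rw [Finset.sum_const, Finset.card_univ, Fintype.card_fin, nsmul_eq_mul]; ring

/-- **ONE LEVEL**: `Σ_{z ∈ periodBox N′} Σ_κ stepMaj d L x ω (z,κ) ≤ (L^{1−d}… written `(L^d)⁻¹·L`) + d·wC d L x)·Σ_{y ∈ periodBox (L·N′)} Σ_μ ω y μ` (`x ≥ 0`). [folklore] -/
theorem sum_stepMaj_le {L N' : ℕ} (hL : 1 ≤ L) (hN : 1 ≤ N') {x : ℝ} (hx : 0 ≤ x) {ω : Site d → Fin d → ℝ} (hω0 : ∀ y μ, 0 ≤ ω y μ)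
    (hωP : ∀ (y : Site d) (μ : Fin d) (i : Fin d), ω (y + ((L * N' : ℕ) : ℤ) • e i) μ = ω y μ) :
    ∑ z ∈ periodBox (d := d) N', ∑ κ : Fin d, stepMaj d L x ω z κ
      ≤ (((L : ℝ) ^ d)⁻¹ * L + d * wC d L x) * ∑ y ∈ periodBox (d := d) (L * N'), ∑ μ : Fin d, ω y μ := by
  have h1 := sum_segStep_le (N' := N') hL hN hωP
  have h2 := sum_locStep_le (N' := N') hL hN hω0 hωP
  have hw := wlin_nonneg d L hx
  have e : ∀ (z : Site d) (κ : Fin d), stepMaj d L x ω z κ = segStep L ω z κ + wlin d L x * locStep L ω z κ := fun z κ => rfl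
  simp_rw [e, Finset.sum_add_distrib, ← Finset.mul_sum]
  have ewC : d * wC d L x = wlin d L x * (d * Csup d L) := by unfold wC wlin; ring
  rw [ewC, add_mul, mul_assoc (wlin d L x)]
  exact add_le_add h1 (mul_le_mul_of_nonneg_left h2 hw)

/-! ## §3 The tower -/

/-- **THE COLUMN PRODUCT** `colProd d L j x = Π_{i<j} ((L^d)⁻¹·L + d·wC d L xᵢ)`, `xᵢ = (prop1Radius d L)^[i] x` (inner-first, like `majIter`). [folklore] -/
def colProd (d L : ℕ) : ℕ → ℝ → ℝ
  | 0, _ => 1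
  | j + 1, x => colProd d L j (prop1Radius d L x) * (((L : ℝ) ^ d)⁻¹ * L + d * wC d L x)

/-- `0 ≤ colProd`. [folklore] -/
theorem colProd_nonneg (d L : ℕ) : ∀ (j : ℕ) {x : ℝ}, 0 ≤ x → 0 ≤ colProd d L j x
  | 0, _, _ => zero_le_one
  | j + 1, _, hx => mul_nonneg (colProd_nonneg d L j (prop1Radius_nonneg hx)) (add_nonneg (by positivity) (mul_nonneg (Nat.cast_nonneg _) (wC_nonneg d L hx)))

/-- **THE COLUMN SUMS OF THE MAJORANT TOWER**: for `L ≥ 1`, `x ≥ 0` and a non-negative `(L^j·N′)`-periodic weight `ω`,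
`Σ_{z ∈ periodBox N′} Σ_κ majIter d L j x ω (z,κ) ≤ colProd d L j x · Σ_{y ∈ periodBox (L^j·N′)} Σ_μ ω y μ`. [folklore] -/
theorem sum_majIter_le {L : ℕ} (hL : 1 ≤ L) : ∀ (j N' : ℕ), 1 ≤ N' → ∀ {x : ℝ}, 0 ≤ x → ∀ {ω : Site d → Fin d → ℝ}, (∀ y μ, 0 ≤ ω y μ) →
    (∀ (y : Site d) (μ : Fin d) (i : Fin d), ω (y + ((L ^ j * N' : ℕ) : ℤ) • e i) μ = ω y μ) →
    ∑ z ∈ periodBox (d := d) N', ∑ κ : Fin d, majIter d L j x ω z κ ≤ colProd d L j x * ∑ y ∈ periodBox (d := d) (L ^ j * N'), ∑ μ : Fin d, ω y μ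
  | 0, N', _, x, _, ω, _, _ => by simp [colProd]
  | j + 1, N', hN, x, hx, ω, hω0, hωP => by
      rw [majIter_succ]
      have hx₁ := prop1Radius_nonneg (d := d) (L := L) hx
      have hω'0 : ∀ y μ, 0 ≤ stepMaj d L x ω y μ := fun y μ => stepMaj_nonneg d L hx (fun y' μ' => hω0 y' μ') y μ
      have hωP' : ∀ (y : Site d) (μ : Fin d) (i : Fin d), ω (y + ((L * (L ^ j * N') : ℕ) : ℤ) • e i) μ = ω y μ := by
        intro y μ i
        have : L * (L ^ j * N') = L ^ (j + 1) * N' := by ring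
        rw [this]; exact hωP y μ i
      have hω'P : ∀ (y : Site d) (μ : Fin d) (i : Fin d), stepMaj d L x ω (y + ((L ^ j * N' : ℕ) : ℤ) • e i) μ = stepMaj d L x ω y μ :=
        fun y μ i => stepMaj_add_period L x hωP' y i μ
      have ih := sum_majIter_le hL j N' hN hx₁ hω'0 hω'P
      have hN'' : 1 ≤ L ^ j * N' := Nat.one_le_iff_ne_zero.mpr (Nat.mul_ne_zero (pow_ne_zero _ (by omega)) (by omega))
      have hstep := sum_stepMaj_le (N' := L ^ j * N') hL hN'' hx hω0 hωP'
      have hP0 := colProd_nonneg d L j hx₁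
      calc ∑ z ∈ periodBox (d := d) N', ∑ κ : Fin d, majIter d L j (prop1Radius d L x) (stepMaj d L x ω) z κ
          ≤ colProd d L j (prop1Radius d L x) * ∑ y ∈ periodBox (d := d) (L ^ j * N'), ∑ μ : Fin d, stepMaj d L x ω y μ := ih
        _ ≤ colProd d L j (prop1Radius d L x) * ((((L : ℝ) ^ d)⁻¹ * L + d * wC d L x) * ∑ y ∈ periodBox (d := d) (L * (L ^ j * N')), ∑ μ : Fin d, ω y μ) :=
            mul_le_mul_of_nonneg_left hstep hP0
        _ = colProd d L (j + 1) x * ∑ y ∈ periodBox (d := d) (L ^ (j + 1) * N'), ∑ μ : Fin d, ω y μ := by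
            rw [show L * (L ^ j * N') = L ^ (j + 1) * N' by ring]
            simp only [colProd]; ring

/-! ## §4 The class evaluation: `colProd ≤ 2·(L^{1−d})^j` -/

/-- `colProd d L j x · (1 − d·L^{d−1}·Ssum d L j x) ≤ ((L^d)⁻¹·L)^j` (`x ≥ 0`, `L ≥ 1`). [folklore] -/
theorem colProd_mul_le {L : ℕ} (hL : 1 ≤ L) : ∀ (j : ℕ) {x : ℝ}, 0 ≤ x →
    colProd d L j x * (1 - d * (L : ℝ) ^ (d - 1) * Ssum d L j x) ≤ (((L : ℝ) ^ d)⁻¹ * L) ^ j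
  | 0, _, _ => by simp [colProd, Ssum]
  | j + 1, x, hx => by
      have hL0 : (0 : ℝ) < L := by exact_mod_cast (by omega : 0 < L)
      have hx₁ := prop1Radius_nonneg (d := d) (L := L) hx
      have ih := colProd_mul_le hL j hx₁
      have hP := colProd_nonneg d L j hx₁
      have hw := wC_nonneg d L hx
      have hS := Ssum_nonneg d L j hx₁
      have hd0 : (0 : ℝ) ≤ d := Nat.cast_nonneg _
      set a : ℝ := ((L : ℝ) ^ d)⁻¹ * L with ha
      have ha0 : 0 < a := by positivity
      -- `a·(d·L^{d−1}) = d` (for `d ≥ 1`; for `d = 0` both sides of the key inequality are handled by `nlinarith`)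
      have hkey : a * ((d : ℝ) * (L : ℝ) ^ (d - 1)) = d := by
        rcases Nat.eq_zero_or_pos d with h0 | hpos
        · subst h0; simp
        · have : (L : ℝ) ^ d = (L : ℝ) ^ (d - 1) * L := by
            rw [← pow_succ]; congr 1; omega
          rw [ha, this]; field_simp
      simp only [colProd, Ssum_succ]
      -- `(a + d w)(1 − c(w + S′)) ≤ a(1 − cS′)` with `c = dL^{d−1}`, `a c = d`
      have halg : (a + d * wC d L x) * (1 - d * (L : ℝ) ^ (d - 1) * (wC d L x + Ssum d L j (prop1Radius d L x)))
          ≤ a * (1 - d * (L : ℝ) ^ (d - 1) * Ssum d L j (prop1Radius d L x)) := by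
        have e : (a + d * wC d L x) * (1 - d * (L : ℝ) ^ (d - 1) * (wC d L x + Ssum d L j (prop1Radius d L x)))
            = a * (1 - d * (L : ℝ) ^ (d - 1) * Ssum d L j (prop1Radius d L x))
              + (d * wC d L x - a * (d * (L : ℝ) ^ (d - 1)) * wC d L x)
              - d * wC d L x * (d * (L : ℝ) ^ (d - 1)) * (wC d L x + Ssum d L j (prop1Radius d L x)) := by ring
        rw [e, hkey, sub_self, add_zero]
        have : 0 ≤ d * wC d L x * (d * (L : ℝ) ^ (d - 1)) * (wC d L x + Ssum d L j (prop1Radius d L x)) := by positivity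
        linarith
      calc colProd d L j (prop1Radius d L x) * (a + d * wC d L x) * (1 - d * (L : ℝ) ^ (d - 1) * (wC d L x + Ssum d L j (prop1Radius d L x)))
          = colProd d L j (prop1Radius d L x) * ((a + d * wC d L x) * (1 - d * (L : ℝ) ^ (d - 1) * (wC d L x + Ssum d L j (prop1Radius d L x)))) := by ring
        _ ≤ colProd d L j (prop1Radius d L x) * (a * (1 - d * (L : ℝ) ^ (d - 1) * Ssum d L j (prop1Radius d L x))) := mul_le_mul_of_nonneg_left halg hP
        _ = a * (colProd d L j (prop1Radius d L x) * (1 - d * (L : ℝ) ^ (d - 1) * Ssum d L j (prop1Radius d L x))) := by ring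
        _ ≤ a * a ^ j := mul_le_mul_of_nonneg_left ih ha0.le
        _ = a ^ (j + 1) := by ring

/-- **`colProd ≤ 2·(L^{1−d})^j` WHEN `d·L^{d−1}·Ssum ≤ 1∕2`** (`x ≥ 0`, `L ≥ 1`). [folklore] -/
theorem colProd_le_two_mul {L : ℕ} (hL : 1 ≤ L) (j : ℕ) {x : ℝ} (hx : 0 ≤ x) (hS : d * (L : ℝ) ^ (d - 1) * Ssum d L j x ≤ 1 / 2) :
    colProd d L j x ≤ 2 * (((L : ℝ) ^ d)⁻¹ * L) ^ j := by
  have h := colProd_mul_le (d := d) hL j hx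
  have hP := colProd_nonneg d L j hx
  have hfac : (1 : ℝ) / 2 ≤ 1 - d * (L : ℝ) ^ (d - 1) * Ssum d L j x := by linarith
  nlinarith [mul_le_mul_of_nonneg_left hfac hP]

end

end Summit.QuantumFields.BalabanUV.T4Continuum.NE7MajorantColumnSums
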